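import Literature.AlgebraicGeometry.Resolution.ThreefoldResolutionDatum
import HarnessLib

/-!
# Cutkosky 2009, §8: algorithms (9) and (10) — the printed invariants and the order-free finiteness of (9) (named facts, procedural form)

Topic: `Literature/AlgebraicGeometry/Resolution`. Per-step ("procedural") NAMED FACTS, statements
only, transcribing the first half of §8 "Reduction to Local Resolution" of S. D. Cutkosky, *Resolution
of singularities for 3-folds in positive characteristic*, Amer. J. Math. **131** (2009) 59–127
[Cutkosky2009] (held author version `paper:doi-10-1353-ajm-0-0036`; "pNN Lmm" = page, line of its
text layer), over the vocabulary of `ThreefoldResolutionDatum.lean` (`ResDatum`, `IsPermissible`,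
`IsTransform`, `ReachBy`, `Run`, `Stable`, `FinSing`, `IsComponentOfSingR`). The ∃-forms of Thm. 7.2
and of the finiteness step are in `ThreefoldResolutionStableForm.lean`.

Printed text (p24 L5–49): "We may assume that the conclusions of Theorem 7.2 hold (but we now have
`R = (E⁺, E⁻, I, V)`). Suppose that `Y ⊂ Sing_r(R)` is an irreducible component. By the conclusions of
Theorem 7.2, `Y` is nonsingular of dimension `≤ 1`, `Y ∩ E⁻ = ∅`, `Y ⊂ E⁺` and there exists an
approximate hypersurface `D_p` to `I` at `p` which is transversal to `E⁺` such that `Y ⊂ D_p`. Thus `Y`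
is transversal to `E`, and the blow up `π_1 : V_1 → V` of `Y` is a permissible transform of `R`.
Furthermore, it follows from Lemmas 5.2 and 7.1 that the conclusions of Theorem 7.2 hold for the
transform `R_1` of `R` on `V_1`. We may thus construct a sequence of permissible transforms (9) … by
applying the following algorithm: 1. If there exists an irreducible curve `C ⊂ Sing_r(R_n)` then
perform the permissible transform `V_{n+1} → V_n` obtained by blowing up `C`. 2. If `Sing_r(R_n)` is a
finite set of points, then blow up a point in `Sing_r(R_n)`. As remarked in the paragraph above (9),
the above blow ups are permissible, and the conclusions of Theorem 7.2 hold for all transforms `R_n`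
of `R` along the sequence (9). We must show that the sequence terminates after a finite number of
steps with `Sing_r(R_n) = ∅`. We first observe that there exists a `V_n` in (9) such that `Sing_r(R_n)`
is a finite set. Suppose otherwise. Then (9) is an infinite sequence, constructed by only performing
Step 1 of the algorithm. By Lemma 5.2, there exists a curve `C` in `Sing_r(R)` such that an infinite
number of sections over `C` are blown up in (9). let `ζ` be the generic point of `C`. As in the
argument following (6) in the proof of Theorem 7.2, the sequence of blow ups of closed points over
`Spec(𝒪_{V,ζ})` obtained by making the base change of (9) with the inclusion of `Spec(𝒪_{V,ζ})` into
`V`, does not reduce the order of the weak transform of `I_n`, a contradiction to Remark 6.2 to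
Theorem 6.1. We may thus assume that `Sing_r(R)` is a finite set. With the assumptions that
`Sing_r(I)` is a finite set of points, and that the conclusions of Theorem 7.2 hold, we now construct
a sequence of permissible transforms (10) … by applying the following algorithm: 1. If there is a
curve in `Sing_r(I_n)`, then blow up the union of one dimensional components of `Sing_r(I_n)`.
2. Otherwise, blow up `Sing_r(I_n)`, which is a finite union of points. By Lemma 5.3, Lemma 5.2, 4 of
Theorem 7.2, and since we started with `Sing_r(I)` on `V` being a finite set of points, under this
algorithm `Sing_r(I_n)` is always a disjoint union of points and nonsingular curves, which are
transversal to `E_n`. The conclusions of Theorem 7.2 hold on all `V_n`."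

## Contents

* Vocabulary (definitions): `ResDatum.IsAlg9CurveCentre` (Step 1 of (9): the reduced structure on ANY
  irreducible closed curve of `Sing_r`), `ResDatum.HasCurveInSingR`, `ResDatum.curvePart` (the union of
  the one-dimensional components of `Sing_r`), `ResDatum.singRClosure`, `ResDatum.IsAlg10Centre` (the
  centre of (10)), `ResDatum.Tidy` ("a disjoint union of points and nonsingular curves transversal to
  `E_n`").
* FOUR NAMED FACTS: `Cutkosky2009_sec8_component_permissible` (p24 L7–11),
  `Cutkosky2009_sec8_component_stable` (p24 L11–13: the one-step invariant of (9)),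
  `Cutkosky2009_sec8_noInfiniteCurveRun` (p24 L27–37: NO infinite run of Step 1 through stable data,
  whatever curves are chosen — print's argument is order-free), `Cutkosky2009_sec8_alg10_invariant`
  (p24 L37–49, in HISTORY form along `ReachBy IsAlg10Centre` from a stable datum with `Sing_r` finite —
  print's justification is "since we started with `Sing_r(I)` … finite").
* PROVED consequences: `Cutkosky2009_sec8_noInfiniteCurveRun.isEmpty_curveRun`, `.of_stable_zero`
  (stability at the start suffices, via the one-step invariant, when the centres are components);
  `Cutkosky2009_sec8_alg10_invariant.at_start`, `.along_run`.

## Faithfulness notes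

* Granularity = print's: the one-step invariant of (9) is printed as a one-step claim (L11–13) and is
  so stated; the invariant of (10) is printed with a historical justification and is stated along
  finite (10)-sequences only. The finiteness of (9) is the `False`-form of print's "Suppose otherwise":
  the refuted object is an infinite sequence of permissible transforms each blowing up an irreducible
  curve of `Sing_r(R_n)`, the conclusions of Thm. 7.2 holding throughout (L24–25) — nothing about the
  ORDER in which curves are chosen is used or stated.
* Centres carry their reduced structure (`vanishingIdeal`); "curve" = irreducible closed subset of
  topological Krull dimension `1`; "component of `Sing_r`" = `IsComponentOfSingR` (maximal irreducible
  subset). "Disjoint union of points and nonsingular curves transversal to `E_n`" = `Tidy` (each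
  component of dimension `≤ 1`, regular, snc with `E⁺ + E⁻`; distinct components disjoint).
* Nothing here asserts that algorithm (10) terminates (that is §§9–10, typed at chain level in
  `CutkoskySurfaceOmegaSequence.lean`, `CutkoskyTauTwoSequence.lean`, `CutkoskyOrderTauBlowup.lean`),
  nor the existence of blow-ups / of the transformed datum (problem side).
* AI transcription; AI review is weaker than expert review.
-/

noncomputable section

namespace Literature.AlgebraicGeometry.Resolution

universe u

open CategoryTheory AlgebraicGeometry TopologicalSpace

/-! ## Vocabulary of algorithms (9) and (10) (definitions only) -/

namespace Cutkosky2009.ResDatum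

variable {k : Type u} [Field k]

/-- **Step 1 of algorithm (9)** (p24 L19–21 "If there exists an irreducible curve `C ⊂ Sing_r(R_n)`
then perform the permissible transform `V_{n+1} → V_n` obtained by blowing up `C`"): the centre is the
reduced structure on an irreducible closed curve `Y ⊆ Sing_r(R)` — ANY such curve (print fixes no
order). [cite: Cutkosky2009, §8 (p. 24 l. 19–21)] -/
def IsAlg9CurveCentre (R : ResDatum k) (C : R.V.IdealSheafData) : Prop :=
  ∃ Y : Closeds R.V, (Y : Set R.V) ⊆ R.singR ∧ IsIrreducible (Y : Set R.V) ∧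
    topologicalKrullDim Y = 1 ∧ C = AlgebraicGeometry.Scheme.IdealSheafData.vanishingIdeal Y

/-- **"There is a curve in `Sing_r(I_n)`"** (p24 L43; also the test of Step 1 of (9), p24 L19): some
irreducible closed one-dimensional subset of `V` lies in `Sing_r(R)`. [cite: Cutkosky2009, §8 (p. 24 l. 19, l. 43)] -/
def HasCurveInSingR (R : ResDatum k) : Prop :=
  ∃ Y : Closeds R.V, (Y : Set R.V) ⊆ R.singR ∧ IsIrreducible (Y : Set R.V) ∧ topologicalKrullDim Y = 1

/-- **"The union of one dimensional components of `Sing_r(I_n)`"** (p24 L43–44), as a closed subset of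
`V` (closure of the union of the one-dimensional irreducible components of `Sing_r(R)`; on the
noetherian `V` the union is finite, hence already closed). [cite: Cutkosky2009, §8 (p. 24 l. 43–44)] -/
def curvePart (R : ResDatum k) : Closeds R.V :=
  ⟨closure (⋃ Y ∈ {Y : Closeds R.V | R.IsComponentOfSingR Y ∧ topologicalKrullDim Y = 1}, (Y : Set R.V)),
    isClosed_closure⟩

/-- **"`Sing_r(I_n)`, which is a finite union of points"** (p24 L45), as a closed subset of `V`
(closure of `Sing_r(R)`; in Step 2 of (10) `Sing_r` is a finite set of closed points, already closed).
[cite: Cutkosky2009, §8 (p. 24 l. 45)] -/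
def singRClosure (R : ResDatum k) : Closeds R.V :=
  ⟨closure R.singR, isClosed_closure⟩

/-- **The centre of algorithm (10) at `R`** (p24 L42–45): "1. If there is a curve in `Sing_r(I_n)`, then
blow up the union of one dimensional components of `Sing_r(I_n)`. 2. Otherwise, blow up `Sing_r(I_n)`,
which is a finite union of points" — with the reduced structures (`vanishingIdeal`).
[cite: Cutkosky2009, §8 (p. 24 l. 42–45)] -/
def IsAlg10Centre (R : ResDatum k) (C : R.V.IdealSheafData) : Prop :=
  (R.HasCurveInSingR → C = AlgebraicGeometry.Scheme.IdealSheafData.vanishingIdeal R.curvePart) ∧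
    (¬ R.HasCurveInSingR → C = AlgebraicGeometry.Scheme.IdealSheafData.vanishingIdeal R.singRClosure)

/-- **"`Sing_r(I_n)` is a disjoint union of points and nonsingular curves, which are transversal to
`E_n`"** (p24 L47–48): every irreducible component `Y` of `Sing_r(R)` has dimension `≤ 1`, its reduced
structure is regular and has simple normal crossings with ("is transversal to", p16 L48–51)
`E = E⁺ + E⁻`, and distinct components are disjoint. [cite: Cutkosky2009, §8 (p. 24 l. 47–48)] -/
def Tidy (R : ResDatum k) : Prop :=
  (∀ Y : Closeds R.V, R.IsComponentOfSingR Y →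
      topologicalKrullDim Y ≤ 1 ∧
        Scheme.IsRegular (AlgebraicGeometry.Scheme.IdealSheafData.vanishingIdeal Y).subscheme ∧
          HasSNCWith R.boundary (AlgebraicGeometry.Scheme.IdealSheafData.vanishingIdeal Y)) ∧
    ∀ Y Y' : Closeds R.V, R.IsComponentOfSingR Y → R.IsComponentOfSingR Y' → Y ≠ Y' →
      Disjoint (Y : Set R.V) (Y' : Set R.V)

/-- A resolved datum has no curve in `Sing_r`. [cite: Cutkosky2009, §8 (p. 24 l. 43)] -/
theorem Resolved.not_hasCurveInSingR {R : ResDatum k} (h : R.Resolved) : ¬ R.HasCurveInSingR := by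
  rintro ⟨Y, hY, hirr, -⟩
  obtain ⟨y, hy⟩ := hirr.nonempty
  have := hY hy
  rw [Resolved] at h
  rw [h] at this
  exact this

end Cutkosky2009.ResDatum

/-! ## Algorithm (9): the printed one-step invariant and the order-free finiteness (procedural form) -/

/-- NAMED FACT — **Cutkosky 2009, §8, the components of `Sing_r` of a stable datum are permissible
centres** (p24 L7–11): "Suppose that `Y ⊂ Sing_r(R)` is an irreducible component. By the conclusions
of Theorem 7.2, `Y` is nonsingular of dimension `≤ 1`, `Y ∩ E⁻ = ∅`, `Y ⊂ E⁺` and there exists an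
approximate hypersurface `D_p` to `I` at `p` which is transversal to `E⁺` such that `Y ⊂ D_p`. Thus
`Y` is transversal to `E`, and the blow up `π_1 : V_1 → V` of `Y` is a permissible transform of `R`."
Rendered: for a stable datum (`Stable` = conclusions (1)–(4) of Thm. 7.2) on a nonsingular 3-fold over
an algebraically closed field and an irreducible component `Y` of `Sing_r(R)`, the reduced closed
subscheme on `Y` (ideal `vanishingIdeal Y`) is a permissible centre (`IsPermissible`: `≠ ⊤`, regular,
inside `Sing_r`, snc with `E⁺ + E⁻`). This serves BOTH steps of (9) (Step 1: an irreducible curve of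
`Sing_r`, a component as `dim Sing_r ≤ 1`; Step 2: a point of the finite set `Sing_r`).
Users take `(h : Cutkosky2009_sec8_component_permissible)`.
[cite: Cutkosky2009, §8 (author version p. 24 l. 7–11)] -/
def Cutkosky2009_sec8_component_permissible : Prop :=
  ∀ (k : Type u) [Field k] [IsAlgClosed k] (R : Cutkosky2009.ResDatum k), R.Stable →
    ∀ Y : Closeds R.V, R.IsComponentOfSingR Y →
      R.IsPermissible (AlgebraicGeometry.Scheme.IdealSheafData.vanishingIdeal Y)

/-- NAMED FACT — **Cutkosky 2009, §8, the conclusions of Thm. 7.2 persist under blowing up a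
component of `Sing_r`** (p24 L11–13, with L24–25): "Furthermore, it follows from Lemmas 5.2 and 7.1
that the conclusions of Theorem 7.2 hold for the transform `R_1` of `R` on `V_1`." … "As remarked in
the paragraph above (9), the above blow ups are permissible, and the conclusions of Theorem 7.2 hold
for all transforms `R_n` of `R` along the sequence (9)." Rendered (single step, as printed at
L11–13): if `R` is stable, `Y` an irreducible component of `Sing_r(R)`, and `R'` the transform of `R`
along a blow-up `τ` of `Y` (reduced structure; `IsTransform` = the `E^±` rule of p19 L5–9), then
`R'` is stable. Users take `(h : Cutkosky2009_sec8_component_stable)`.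
[cite: Cutkosky2009, §8 (author version p. 24 l. 11–13, l. 24–25)] -/
def Cutkosky2009_sec8_component_stable : Prop :=
  ∀ (k : Type u) [Field k] [IsAlgClosed k] (R R' : Cutkosky2009.ResDatum k), R.Stable →
    ∀ (Y : Closeds R.V) (τ : R'.V ⟶ R.V), R.IsComponentOfSingR Y →
      R.IsTransform R' (AlgebraicGeometry.Scheme.IdealSheafData.vanishingIdeal Y) τ → R'.Stable

/-- NAMED FACT — **Cutkosky 2009, §8, finiteness along (9) in its printed, ORDER-FREE form**
(p24 L27–37): "We first observe that there exists a `V_n` in (9) such that `Sing_r(R_n)` is a finite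
set. Suppose otherwise. Then (9) is an infinite sequence, constructed by only performing Step 1 of the
algorithm [Step 1, p24 L19–21: "If there exists an irreducible curve `C ⊂ Sing_r(R_n)` then perform
the permissible transform `V_{n+1} → V_n` obtained by blowing up `C`" — ANY such curve, no order is
fixed]. By Lemma 5.2, there exists a curve `C` in `Sing_r(R)` such that an infinite number of sections
over `C` are blown up in (9). let `ζ` be the generic point of `C`. As in the argument following (6) in
the proof of Theorem 7.2, the sequence of blow ups of closed points over `Spec(𝒪_{V,ζ})` obtained by
making the base change of (9) with the inclusion of `Spec(𝒪_{V,ζ})` into `V`, does not reduce the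
order of the weak transform of `I_n`, a contradiction to Remark 6.2 to Theorem 6.1." The printed
argument refutes EVERY infinite run of Step 1 along which the conclusions of Thm. 7.2 hold (p24
L24–25: they do hold along (9)), whatever curves are chosen. Rendered: there is no infinite run of
permissible transforms (`Run`: data `R_n`, centres, blow-up maps, each step an `IsTransform`) all of
whose data are stable and all of whose centres are irreducible curves of `Sing_r(R_n)` with their
reduced structure (`IsAlg9CurveCentre`). Users take `(h : Cutkosky2009_sec8_noInfiniteCurveRun)`.
[cite: Cutkosky2009, §8 (author version p. 24 l. 19–21, l. 24–25, l. 27–37)] -/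
def Cutkosky2009_sec8_noInfiniteCurveRun : Prop :=
  ∀ (k : Type u) [Field k] [IsAlgClosed k] (ρ : Cutkosky2009.Run k), (∀ n, (ρ.datum n).Stable) →
    (∀ n, (ρ.datum n).IsAlg9CurveCentre (ρ.centre n)) → False

namespace Cutkosky2009_sec8_noInfiniteCurveRun

variable {k : Type u} [Field k] [IsAlgClosed k]

/-- **The `IsEmpty` form**: there is no infinite run of Step 1 of (9) through stable data starting at a
given datum — the shape of the chain hypotheses consumed on the problem side (`hF63c_nine`-type
inputs of `DatumReduction.Sig56` instances). [cite: Cutkosky2009, §8 (p. 24 l. 27–37)] -/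
theorem isEmpty_curveRun (h : Cutkosky2009_sec8_noInfiniteCurveRun.{u}) (R : Cutkosky2009.ResDatum k) :
    IsEmpty {ρ : Cutkosky2009.Run k // ρ.datum 0 = R ∧ (∀ n, (ρ.datum n).Stable) ∧
      ∀ n, (ρ.datum n).IsAlg9CurveCentre (ρ.centre n)} :=
  ⟨fun ⟨ρ, _, hs, hc⟩ => h k ρ hs hc⟩

/-- With the one-step invariant (`Cutkosky2009_sec8_component_stable`) the stability hypothesis is
needed at the START only, provided every Step-1 centre is a COMPONENT of `Sing_r` (which it is when
`dim Sing_r ≤ 1`; that topological remark is left to the user): no infinite run of Step 1 from a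
stable datum whose centres are one-dimensional irreducible components. [cite: Cutkosky2009, §8 (p. 24 l. 11–13, l. 24–37)] -/
theorem of_stable_zero (h : Cutkosky2009_sec8_noInfiniteCurveRun.{u})
    (hinv : Cutkosky2009_sec8_component_stable.{u}) (ρ : Cutkosky2009.Run k) (h0 : (ρ.datum 0).Stable)
    (hc : ∀ n, ∃ Y : Closeds (ρ.datum n).V, (ρ.datum n).IsComponentOfSingR Y ∧
      topologicalKrullDim Y = 1 ∧
        ρ.centre n = AlgebraicGeometry.Scheme.IdealSheafData.vanishingIdeal Y) : False := by
  have hs : ∀ n, (ρ.datum n).Stable := by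
    intro n
    induction n with
    | zero => exact h0
    | succ n ih =>
      obtain ⟨Y, hY, -, hcY⟩ := hc n
      have hT := ρ.isTransform n
      rw [hcY] at hT
      exact hinv k (ρ.datum n) (ρ.datum (n + 1)) ih Y (ρ.map n) hY hT
  refine h k ρ hs fun n => ?_
  obtain ⟨Y, hY, hd, hcY⟩ := hc n
  exact ⟨Y, hY.1, hY.2.1, hd, hcY⟩

end Cutkosky2009_sec8_noInfiniteCurveRun

/-! ## Algorithm (10): the printed invariant, in history form -/

/-- NAMED FACT — **Cutkosky 2009, §8, the invariant of algorithm (10)** (p24 L37–49): "With the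
assumptions that `Sing_r(I)` is a finite set of points, and that the conclusions of Theorem 7.2 hold,
we now construct a sequence of permissible transforms (10) `⋯ → V_n → V_{n−1} → ⋯ → V_1 → V` by
applying the following algorithm: 1. If there is a curve in `Sing_r(I_n)`, then blow up the union of
one dimensional components of `Sing_r(I_n)`. 2. Otherwise, blow up `Sing_r(I_n)`, which is a finite
union of points. By Lemma 5.3, Lemma 5.2, 4 of Theorem 7.2, and since we started with `Sing_r(I)` on
`V` being a finite set of points, under this algorithm `Sing_r(I_n)` is always a disjoint union of
points and nonsingular curves, which are transversal to `E_n`. The conclusions of Theorem 7.2 hold on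
all `V_n`." The printed justification is HISTORICAL ("since we started with `Sing_r(I)` … finite"), so
the fact is stated along finite runs of (10) (`ReachBy IsAlg10Centre`) from a stable datum with finite
singular locus, not as a one-step persistence: every datum `R` so reached (i) satisfies the conclusions
of Thm. 7.2 (`Stable`), (ii) has `Sing_r(R)` a disjoint union of points and nonsingular curves
transversal to `E` (`Tidy`), and (iii) — "we now construct a sequence of permissible transforms … by
applying the following algorithm" — its (10)-centre is a permissible centre as long as
`Sing_r(R) ≠ ∅`. Users take `(h : Cutkosky2009_sec8_alg10_invariant)`.
[cite: Cutkosky2009, §8 (author version p. 24 l. 37–49)] -/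
def Cutkosky2009_sec8_alg10_invariant : Prop :=
  ∀ (k : Type u) [Field k] [IsAlgClosed k] (R₀ R : Cutkosky2009.ResDatum k), R₀.Stable → R₀.FinSing →
    Cutkosky2009.ResDatum.ReachBy Cutkosky2009.ResDatum.IsAlg10Centre R₀ R →
      R.Stable ∧ R.Tidy ∧
        (R.singR.Nonempty → ∀ C : R.V.IdealSheafData, R.IsAlg10Centre C → R.IsPermissible C)

namespace Cutkosky2009_sec8_alg10_invariant

variable {k : Type u} [Field k] [IsAlgClosed k]

/-- The invariant at the start (empty sequence): a stable datum with finite singular locus is tidy and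
its (10)-centre is permissible. [cite: Cutkosky2009, §8 (p. 24 l. 37–49), case `n = 0`] -/
theorem at_start (h : Cutkosky2009_sec8_alg10_invariant.{u}) (R : Cutkosky2009.ResDatum k)
    (hs : R.Stable) (hf : R.FinSing) :
    R.Tidy ∧ (R.singR.Nonempty → ∀ C : R.V.IdealSheafData, R.IsAlg10Centre C → R.IsPermissible C) :=
  (h k R R hs hf Relation.ReflTransGen.refl).2

/-- The invariant along an infinite run of (10) (`Run` whose centres are the (10)-centres) from a
stable datum with finite singular locus: every `R_n` is stable and tidy — the standing situation of
§§9–10 (p25 L1 onward). [cite: Cutkosky2009, §8 (p. 24 l. 46–49)] -/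
theorem along_run (h : Cutkosky2009_sec8_alg10_invariant.{u}) (ρ : Cutkosky2009.Run k)
    (h0 : (ρ.datum 0).Stable) (hf : (ρ.datum 0).FinSing)
    (hc : ∀ n, (ρ.datum n).IsAlg10Centre (ρ.centre n)) (n : ℕ) :
    (ρ.datum n).Stable ∧ (ρ.datum n).Tidy := by
  have hr : Cutkosky2009.ResDatum.ReachBy Cutkosky2009.ResDatum.IsAlg10Centre (ρ.datum 0) (ρ.datum n) := by
    induction n with
    | zero => exact Relation.ReflTransGen.refl
    | succ n ih => exact Relation.ReflTransGen.tail ih ⟨ρ.centre n, ρ.map n, hc n, ρ.isTransform n⟩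
  have := h k (ρ.datum 0) (ρ.datum n) h0 hf hr
  exact ⟨this.1, this.2.1⟩

end Cutkosky2009_sec8_alg10_invariant

end Literature.AlgebraicGeometry.Resolution

end
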